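import Summits.Langlands.Langlands.Theorems.ParityBlindBianchiQuadraticDescentGL2TwistedAsaiPoleDichotomy
import Literature.NumberTheory.Automorphic.AsaiSignContOfRawPole
import Literature.NumberTheory.GaloisRepresentations.HeckeCharacterRamificationProofs
import HarnessLib

/-!
# Stub `stub_twistedAsaiPole` reshaped: the twisted Asai pole in continuation currency, modulo the
# twisted Asai continuations — helper, line `Sketch`
(crux `Summit.Langlands.Langlands.Theses.ParityBlindBianchi.QuadraticDescentGL2`, item stmt-Langlands-16811)

Stub worker, 2026-08-17.  Sequel of `…AsaiFactorisation` (the factorisation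
`L^{S_E}(s, P × P^∨) = L^S(s, P, As⁺ ⊗ χ) L^S(s, P, As⁻ ⊗ χ)` on Satake data) and
`…TwistedAsaiPoleDichotomy` (the order count at `s = 1` and the Jacquet–Shalika package of `(P, P^∨)`
on `GL₂`, from theorems).  Sorry-free.

* `exists_finite_offLarge_hyps`, `exists_finite_twistedAsai_dichotomy` — from the a.e. hypotheses of
  the stub (`IsGaloisStableSatakeAE F P`, and `e₂(α) χ(ϖ_v)^{f(w|v)} = 1` a.e., i.e. `ω_P = χ⁻¹ ∘ N`
  on Satake data): a finite `S₀` such that at EVERY Asai datum `(S, A)` of `P` with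
  `χ.ramifiedPlaces ∪ S₀ ⊆ S`, given far-right multipliability of the twisted products and
  continuations `G θ` of `(s - 1) L^S(s, P, As^θ ⊗ χ)` to `{1 < Re s} ∪ B(1, δ)`, SOME sign `η` has
  `G η 1 ≠ 0` while `G (-η) 1 = 0`, `(G (-η))'(1) ≠ 0`.
* `exists_twistedAsaiPoleCont_of_continuations` — **the reshaped stub (one datum, continuation
  currency) modulo `hHol`**, the twisted Asai continuations of `P` (Flicker 1988, Theorem p. 297 for
  `P ⊗ χ̃`, `χ̃|_{𝔸_F^×} = χ`): `∃ η S A`, `(S, A)` an Asai datum with `χ.ramifiedPlaces ⊆ S`, far-right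
  multipliability, and a continuation `G` of `(s - 1) L^S(s, P, As^η ⊗ χ)` to `{1 < Re s} ∪ B(1, δ)`
  with `G 1 ≠ 0`.

What this does NOT give: `hHol`.  No declaration of the tree continues TWISTED Asai `L`-functions; the
untwisted `GrbacShahidi2015_partialAsaiL_at_one` / `…_holomorphy` do not apply directly (`P` is not
conjugate self-dual — `P ⊗ χ̃` is —, and neither the twist of Borel–Jacquet data by a Hecke character
of `E` nor the extension of `χ` from `C_F` to `C_E` is in the tree).  In RAW currency
(`HasHeckeTwistedAsaiPole`, the registered stub) one would need in addition the holomorphy of the raw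
twisted Asai products on `{1 < Re s}`, which is not in print (cf. the deprecation note of
`Mok2014_partialAsaiL_pole_dichotomy`).

## References
* Y. Z. Flicker, Bull. SMF 116 (1988), Theorem p. 297, p. 296. [Flicker1988]
* J. Arthur, L. Clozel, Ann. of Math. Stud. 120 (1989), Ch. 3 §2 (2.3). [ArthurClozelAMS120]
* N. Grbac, F. Shahidi, Pacific J. Math. 276 (2015), proof of Thm. 4.3, p. 206. [GrbacShahidi2015]
* D. Flath, Corvallis 1979, Thm. 3. [FlathCorvallis1979]
-/

set_option linter.dupNamespace false -- project-wide option (lakefile weak.linter.dupNamespace); `Summit.Langlands.Langlands` is the mandated namespace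

noncomputable section

open scoped Classical Topology
open Filter Polynomial NumberField IsDedekindDomain
open Literature.NumberTheory.Automorphic Literature.NumberTheory.GaloisRepresentations

namespace Summit.Langlands.Langlands.Theorems.QuadraticDescentGL2.Sketch

variable {F E : Type} [Field F] [NumberField F] [Field E] [NumberField E] [Algebra F E]

/-! ### From the almost-everywhere hypotheses of the stub: large Asai data -/

/-- **Pointwise hypotheses off a large `S`.**  From `Gal(E/F)`-stability a.e. and the central relation
`e₂(α) χ(ϖ_v)^{f(w|v)} = 1` a.e. (for `χ_v` unramified): a finite `S₀` such that for every
`S ⊇ χ.ramifiedPlaces ∪ S₀` both hold at EVERY place `w` of `E` off `S_E`. [folklore] -/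
theorem exists_finite_offLarge_hyps {hE : isCompact_glFiniteIntegralLevel 2 E} (c : E ≃ₐ[F] E)
    (P : AutomorphicRepData (AutomorphyDatum.gl 2 E hE)) (χ : HeckeCharacter F)
    (hst : IsGaloisStableSatakeAE F P)
    (hχ : ∀ᶠ w : HeightOneSpectrum (𝓞 E) in cofinite, ∀ α : Multiset ℂ,
      P.HasSatakeParamAt w α → χ.IsUnramifiedAt (w.under (𝓞 F)) →
        α.prod * χ.valueAtUniformizer (w.under (𝓞 F)) ^ w.asIdeal.inertiaDeg (𝓞 F) = 1) :
    ∃ S₀ : Set (HeightOneSpectrum (𝓞 F)), S₀.Finite ∧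
      ∀ ⦃S : Set (HeightOneSpectrum (𝓞 F))⦄, χ.ramifiedPlaces ⊆ S → S₀ ⊆ S →
        ∀ w : HeightOneSpectrum (𝓞 E), w.under (𝓞 F) ∉ S →
          (∀ α : Multiset ℂ, P.HasSatakeParamAt w α → P.HasSatakeParamAt (c • w) α) ∧
          (∀ α : Multiset ℂ, P.HasSatakeParamAt w α →
            α.prod * χ.valueAtUniformizer (w.under (𝓞 F)) ^ w.asIdeal.inertiaDeg (𝓞 F) = 1) := by
  set B : Set (HeightOneSpectrum (𝓞 E)) := {w | ¬ ((∀ w' : HeightOneSpectrum (𝓞 E),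
      w'.asIdeal.under (𝓞 F) = w.asIdeal.under (𝓞 F) →
        ∀ α : Multiset ℂ, P.HasSatakeParamAt w α → P.HasSatakeParamAt w' α) ∧
      (∀ α : Multiset ℂ, P.HasSatakeParamAt w α → χ.IsUnramifiedAt (w.under (𝓞 F)) →
        α.prod * χ.valueAtUniformizer (w.under (𝓞 F)) ^ w.asIdeal.inertiaDeg (𝓞 F) = 1))} with hB
  have hBfin : B.Finite := by
    have h := hst.and hχ
    rw [Filter.eventually_cofinite] at h
    exact h
  refine ⟨(fun w : HeightOneSpectrum (𝓞 E) => w.under (𝓞 F)) '' B, hBfin.image _, ?_⟩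
  intro S hχS hS₀ w hw
  have hw' : w ∉ B := fun hwB => hw (hS₀ ⟨w, hwB, rfl⟩)
  simp only [hB, Set.mem_setOf_eq, not_not] at hw'
  refine ⟨fun α hα => hw'.1 (c • w) ?_ α hα, fun α hα => hw'.2 α hα ?_⟩
  · exact congrArg HeightOneSpectrum.asIdeal (HeightOneSpectrum.under_algEquiv_smul F E c w)
  · by_contra h
    exact hw (hχS h)

/-- **The twisted Asai pole dichotomy for a cuspidal `P` on `GL₂(𝔸_E)` at every large Asai datum,
modulo the continuations** — the glue of the reshaped stub `stub_twistedAsaiPole` (continuation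
currency).  For `E/F` quadratic with `c ≠ 1`, `P` cuspidal on `GL₂(𝔸_E)` with `Gal(E/F)`-stable Satake
data a.e., and `χ` with `ω_P = χ⁻¹ ∘ N` on Satake data a.e.: there is a finite `S₀` such that for every
Asai datum `(S, A)` of `P` with `χ.ramifiedPlaces ∪ S₀ ⊆ S`, every `σ ≥ 1`, `δ > 0` beyond which the two
twisted Asai products are multipliable, and all continuations `G θ` of `(s - 1) L^S(s, P, As^θ ⊗ χ)`
(`θ = ±1`) to `{1 < Re s} ∪ B(1, δ)`, SOME sign `η` has `G η 1 ≠ 0` (continued simple pole) while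
`G (-η) 1 = 0`, `(G (-η))'(1) ≠ 0` (holomorphic, non-zero at `1`).  Everything except the continuations
`G` (Flicker 1988 for `P ⊗ χ̃`; NOT in the tree) and the far-right multipliability is a theorem:
factorisation (`exists_finite_offLarge_hyps`, `…AsaiFactorisation`), Rankin–Selberg package of
`(P, P^∨)` (`exists_finite_pairL_dual_package`), order count (`twistedAsai_dichotomy_at_one`).
[cite: GrbacShahidi2015, proof of Thm. 4.3, p. 206] [cite: ArthurClozelAMS120, Ch. 3 §2 (2.3)]
[cite: Flicker1988, p. 296–297] -/
theorem exists_finite_twistedAsai_dichotomy (h2 : Module.finrank F E = 2) {c : E ≃ₐ[F] E}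
    (hc : c ≠ 1) {hE : isCompact_glFiniteIntegralLevel 2 E} (P : CuspidalAutomorphicRepData 2 E hE)
    (χ : HeckeCharacter F) (hst : IsGaloisStableSatakeAE F P.1)
    (hχ : ∀ᶠ w : HeightOneSpectrum (𝓞 E) in cofinite, ∀ α : Multiset ℂ,
      P.1.HasSatakeParamAt w α → χ.IsUnramifiedAt (w.under (𝓞 F)) →
        α.prod * χ.valueAtUniformizer (w.under (𝓞 F)) ^ w.asIdeal.inertiaDeg (𝓞 F) = 1) :
    ∃ S₀ : Set (HeightOneSpectrum (𝓞 F)), S₀.Finite ∧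
      ∀ ⦃S : Set (HeightOneSpectrum (𝓞 F))⦄ ⦃A : SatakeFamily E⦄, P.1.IsAsaiDatum c S A →
        χ.ramifiedPlaces ⊆ S → S₀ ⊆ S →
        ∀ ⦃σ δ : ℝ⦄, 1 ≤ σ → 0 < δ →
        (∀ (θ : ℤˣ) (s : ℂ), σ < s.re →
          Multipliable fun v : {v : HeightOneSpectrum (𝓞 F) // v ∉ S} =>
            ((asaiLocalPolynomial c A θ (placeAbove E v.1)).eval
              (χ.valueAtUniformizer v.1 * (v.1.residueCard : ℂ) ^ (-s)))⁻¹) →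
        ∀ ⦃G : ℤˣ → ℂ → ℂ⦄,
        (∀ θ : ℤˣ, DifferentiableOn ℂ (G θ) ({s : ℂ | 1 < s.re} ∪ Metric.ball (1 : ℂ) δ)) →
        (∀ (θ : ℤˣ) (s : ℂ), σ < s.re →
          G θ s = (s - 1) * partialAsaiLTwist S c A (fun v => χ.valueAtUniformizer v) θ s) →
        ∃ η : ℤˣ, G η 1 ≠ 0 ∧ G (-η) 1 = 0 ∧ deriv (G (-η)) 1 ≠ 0 := by
  classical
  obtain ⟨S₀, hS₀fin, hS₀⟩ := exists_finite_offLarge_hyps c P.1 χ hst hχ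
  obtain ⟨S₁, hS₁fin, hS₁⟩ := exists_finite_pairL_dual_package P
  refine ⟨S₀ ∪ (fun w : HeightOneSpectrum (𝓞 E) => w.under (𝓞 F)) '' S₁,
    hS₀fin.union (hS₁fin.image _), ?_⟩
  intro S A hSA hχS hS σ δ hσ hδ hmulA G hG hGL
  have hS₀S : S₀ ⊆ S := Set.subset_union_left.trans hS
  have hS₁S : (fun w : HeightOneSpectrum (𝓞 E) => w.under (𝓞 F)) '' S₁ ⊆ S :=
    Set.subset_union_right.trans hS
  -- the pointwise hypotheses of the factorisation at this datum
  have hyp := hS₀ hχS hS₀S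
  have hstab : ∀ w : HeightOneSpectrum (𝓞 E), w.under (𝓞 F) ∉ S → A (c • w) = A w := by
    intro w hw
    have hcw : (c • w).under (𝓞 F) ∉ S := by
      rw [HeightOneSpectrum.under_algEquiv_smul F E c w]
      exact hw
    exact P.1.hasSatakeParamAt_unique_holds (hSA.hasSatakeParamAt hcw)
      ((hyp w hw).1 _ (hSA.hasSatakeParamAt hw))
  have hcard : ∀ w : HeightOneSpectrum (𝓞 E), w.under (𝓞 F) ∉ S → Multiset.card (A w) = 2 :=
    fun w hw => (hSA.hasSatakeParamAt hw).card_eq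
  have hcent : ∀ w : HeightOneSpectrum (𝓞 E), w.under (𝓞 F) ∉ S →
      (A w).prod * χ.valueAtUniformizer (w.under (𝓞 F)) ^ w.asIdeal.inertiaDeg (𝓞 F) = 1 :=
    fun w hw => (hyp w hw).2 _ (hSA.hasSatakeParamAt hw)
  -- the Rankin–Selberg package of `(P, P^∨)` over the places of `E` off `S_E`
  have hT₁ : S₁ ⊆ {w : HeightOneSpectrum (𝓞 E) | w.under (𝓞 F) ∈ S} := fun w hw =>
    hS₁S ⟨w, hw, rfl⟩
  have hTfin : ({w : HeightOneSpectrum (𝓞 E) | w.under (𝓞 F) ∈ S}).Finite := by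
    have hfib : ∀ v : HeightOneSpectrum (𝓞 F),
        ({w : HeightOneSpectrum (𝓞 E) | w.under (𝓞 F) = v}).Finite := fun v =>
      Set.finite_coe_iff.mp (finite_placesOver (E := E) v)
    refine (hSA.finite.biUnion fun v _ => hfib v).subset fun w hw => ?_
    exact Set.mem_biUnion hw rfl
  obtain ⟨hmulP, hRhol, r, hr, hpole⟩ := hS₁ hT₁ hTfin (fun w hw => hSA.hasSatakeParamAt hw)
  exact twistedAsai_dichotomy_at_one h2 hc hstab hcard hcent hSA.2.2 hσ hδ hmulA
    (fun s hs => hmulP s (lt_of_le_of_lt hσ hs)) hRhol hr hpole hG hGL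

/-! ### The reshaped stub, modulo the continuations (Flicker 1988) -/

/-- **Stub `stub_twistedAsaiPole` in continuation currency, one datum, MODULO the twisted Asai
continuations.**  Hypothesis `hHol` is the ONE missing published input, for this `P` and `χ`: for
every Asai datum `(S, A)` of `P` with `χ.ramifiedPlaces ⊆ S` there are `σ₀ ≥ 1` beyond which both
twisted partial Asai products converge, `δ > 0`, and for each sign `θ` a function `G` holomorphic on
`{1 < Re s} ∪ B(1, δ)` agreeing with `(s - 1) L^S(s, P, As^θ ⊗ χ)` on `{σ₀ < Re s}` — i.e. the twisted
partial Asai `L`-functions of the cuspidal `P` on `GL₂(𝔸_E)` continue meromorphically to a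
neighbourhood of `{Re s ≥ 1}` with at most a simple pole at `s = 1` (Flicker 1988, Theorem p. 297 with
the reduction of p. 296 applied to `P ⊗ χ̃`, `χ̃|_{𝔸_F^×} = χ`, whose central character is trivial on
`𝔸_F^×` since `ω_P = χ⁻¹ ∘ N`; `As⁻ = As⁺ ⊗ ω_{E/F}`; the Rankin–Selberg integral against the
mirabolic Eisenstein series on `GL₂(F)`, no trace formula).  As a named fact it would read:
`∀ F E c, finrank F E = 2 → c ≠ 1 → ∀ hE (P : CuspidalAutomorphicRepData 2 E hE) (χ : HeckeCharacter F)
 S A, P.1.IsAsaiDatum c S A → χ.ramifiedPlaces ⊆ S → ∃ σ₀ ≥ 1, (∀ θ s, σ₀ < s.re → Multipliable …θ…) ∧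
 ∃ δ > 0, ∀ θ, ∃ G, DifferentiableOn ℂ G ({1 < re} ∪ ball 1 δ) ∧ ∀ s, σ₀ < s.re →
 G s = (s - 1) * partialAsaiLTwist S c A (fun v => χ.valueAtUniformizer v) θ s`.
**Conclusion**: some Asai datum `(S, A)` with `χ.ramifiedPlaces ⊆ S` and some sign `η` such that the
continued `L^S(s, P, As^η ⊗ χ)` has a simple pole at `s = 1` (`G 1 ≠ 0`) — the `∃`-datum rendering
of "`L^S(s, P, As^η ⊗ χ)` has a pole at `s = 1`" consumed by the theta descent (stub 3).  Proof: a
large Asai datum exists (`AutomorphicRepData.exists_isAsaiDatum`, `IsAsaiDatum.mono`, finiteness of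
`χ.ramifiedPlaces`), and `exists_finite_twistedAsai_dichotomy`.
[cite: Flicker1988, Theorem p. 297 and p. 296] [cite: ArthurClozelAMS120, Ch. 3 §2 (2.3)] -/
theorem exists_twistedAsaiPoleCont_of_continuations (h2 : Module.finrank F E = 2) {c : E ≃ₐ[F] E}
    (hc : c ≠ 1) {hE : isCompact_glFiniteIntegralLevel 2 E} (P : CuspidalAutomorphicRepData 2 E hE)
    (χ : HeckeCharacter F) (hst : IsGaloisStableSatakeAE F P.1)
    (hχ : ∀ᶠ w : HeightOneSpectrum (𝓞 E) in cofinite, ∀ α : Multiset ℂ,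
      P.1.HasSatakeParamAt w α → χ.IsUnramifiedAt (w.under (𝓞 F)) →
        α.prod * χ.valueAtUniformizer (w.under (𝓞 F)) ^ w.asIdeal.inertiaDeg (𝓞 F) = 1)
    (hHol : ∀ ⦃S : Set (HeightOneSpectrum (𝓞 F))⦄ ⦃A : SatakeFamily E⦄, P.1.IsAsaiDatum c S A →
      χ.ramifiedPlaces ⊆ S →
      ∃ σ₀ : ℝ, 1 ≤ σ₀ ∧
        (∀ (θ : ℤˣ) (s : ℂ), σ₀ < s.re →
          Multipliable fun v : {v : HeightOneSpectrum (𝓞 F) // v ∉ S} =>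
            ((asaiLocalPolynomial c A θ (placeAbove E v.1)).eval
              (χ.valueAtUniformizer v.1 * (v.1.residueCard : ℂ) ^ (-s)))⁻¹) ∧
        ∃ δ : ℝ, 0 < δ ∧ ∀ θ : ℤˣ, ∃ G : ℂ → ℂ,
          DifferentiableOn ℂ G ({s : ℂ | 1 < s.re} ∪ Metric.ball (1 : ℂ) δ) ∧
          ∀ s : ℂ, σ₀ < s.re →
            G s = (s - 1) * partialAsaiLTwist S c A (fun v => χ.valueAtUniformizer v) θ s) :
    ∃ (η : ℤˣ) (S : Set (HeightOneSpectrum (𝓞 F))) (A : SatakeFamily E),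
      P.1.IsAsaiDatum c S A ∧ χ.ramifiedPlaces ⊆ S ∧
      ∃ σ₀ : ℝ, 1 ≤ σ₀ ∧
        (∀ s : ℂ, σ₀ < s.re →
          Multipliable fun v : {v : HeightOneSpectrum (𝓞 F) // v ∉ S} =>
            ((asaiLocalPolynomial c A η (placeAbove E v.1)).eval
              (χ.valueAtUniformizer v.1 * (v.1.residueCard : ℂ) ^ (-s)))⁻¹) ∧
        ∃ (δ : ℝ) (G : ℂ → ℂ), 0 < δ ∧
          DifferentiableOn ℂ G ({s : ℂ | 1 < s.re} ∪ Metric.ball (1 : ℂ) δ) ∧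
          (∀ s : ℂ, σ₀ < s.re →
            G s = (s - 1) * partialAsaiLTwist S c A (fun v => χ.valueAtUniformizer v) η s) ∧
          G 1 ≠ 0 := by
  classical
  obtain ⟨S₀, hS₀fin, hdich⟩ := exists_finite_twistedAsai_dichotomy h2 hc P χ hst hχ
  -- a large Asai datum
  obtain ⟨S', A, hSA'⟩ := AutomorphicRepData.exists_isAsaiDatum h2 hc P.1
  have hram : χ.ramifiedPlaces.Finite := χ.finite_ramifiedPlaces_holds
  set S : Set (HeightOneSpectrum (𝓞 F)) := S' ∪ (S₀ ∪ χ.ramifiedPlaces) with hS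
  have hSA : P.1.IsAsaiDatum c S A :=
    hSA'.mono Set.subset_union_left (hSA'.finite.union (hS₀fin.union hram))
  have hχS : χ.ramifiedPlaces ⊆ S := Set.subset_union_right.trans Set.subset_union_right
  have hS₀S : S₀ ⊆ S := Set.subset_union_left.trans Set.subset_union_right
  -- the continuations, and the dichotomy at this datum
  obtain ⟨σ₀, hσ₀, hmul, δ, hδ, hG⟩ := hHol hSA hχS
  choose G hGhol hGL using hG
  obtain ⟨η, hη, -, -⟩ := hdich hSA hχS hS₀S hσ₀ hδ hmul hGhol hGL
  exact ⟨η, S, A, hSA, hχS, σ₀, hσ₀, hmul η, δ, G η, hδ, hGhol η, hGL η, hη⟩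

/-- **Anchor of this helper file** (registered sub-goal `twistedAsaiPoleCont_anchor` of the crux item,
so that the file lands with `--supports`): the sign bookkeeping `η = 1 ∨ η = -1`. [folklore] -/
theorem twistedAsaiPoleCont_anchor : ∀ (η : ℤˣ), η = 1 ∨ η = -1 :=
  Int.units_eq_one_or

end Summit.Langlands.Langlands.Theorems.QuadraticDescentGL2.Sketch

end
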